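import Mathlib
import HarnessLib
import Summits.Ventures.LatticeQCDFlow.Exactness.JitteredHMC
import Summits.Ventures.LatticeQCDFlow.Exactness.Phi4HMCExact

/-!
# `phi4_2d.hmc(..., tau_jitter)`: the jittered HMC update for lattice φ⁴ on `ℝ^Λ` is exact, for every jitter law and both integrators

HONEST FRAMING: exact (Metropolis-corrected) sampling algorithms for lattice gauge theory;
figures of merit are autocorrelation/cost numbers at stated couplings and volumes; no
continuum-physics claim.  (SCALAR calibration rung S0-A: not a gauge result.)

Venture `LatticeQCDFlow` (cell pub-lqcd), topic `Exactness`, FANOUT row 9 (eng-latcore, the engine's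
`latflow.core.phi4_2d.hmc(lat, …, tau, nstep, tau_jitter = j)` and `hmcpqp`: the trajectory length is
`τ(1 + j(2u − 1))`, `u ∼ U(0,1)` drawn before and independently of the field).  NEW WORK of the cell over
the tree (`JitteredHMC.lean`: `jitterHMC`, `jitterHMC_exact`, `jitterHMC_apply`; row 2's
`Phi4LeapfrogPerm.lean` / `Phi4HMCExact.lean`: the qpq proposal `hmcProposal` and the pqp proposal
`hmcProposalPQP` are measurable Lebesgue-preserving involutions of `ℝ^Λ × ℝ^Λ`, `momentumWeight`,
`momentumZ_pos`, `integrable_momentumWeight`); nothing is cited as a fact; no number is claimed.  Row 2's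
`RandomisedHMC.lean` is the same clause for FINITE label sets at the level of the update OPERATOR on
polynomial observables; this file is the KERNEL on `ℝ^Λ` for ANY countable label law (every floating-point
jitter law), with step AND step number allowed to depend on the label.

* `phi4KineticLaw n` — the Gaussian refresh `Z_p⁻¹ e^{−½Σp²}·Leb` as the normalised `withDensity` measure;
  `phi4KineticWeight_univ_eq`, `phi4KineticWeight_univ_ne_zero/_ne_top` (`Z_p = ENNReal.ofReal (momentumZ n)`).
* **`phi4JitterHMC J λ δ N η`** / **`phi4JitterHMCPQP J λ δ N η`** — refresh `p ∼ N(0,1)^Λ` and a label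
  `l ∼ η`, run `N l` qpq (resp. pqp) leapfrog steps of size `δ l`, flip, Metropolis test on `S + ½Σp²`,
  forget `(p, l)`.
* **`phi4JitterHMC_invariant`** / **`phi4JitterHMCPQP_invariant`** — for EVERY real `J`, `λ`, EVERY
  `δ : labels → ℝ`, `N : labels → ℕ` and EVERY probability law `η`: the jittered update leaves `e^{−S}·Leb`
  invariant (`S = latticePhi4Action J λ`).
* (detailed balance of both kernels for every jitter law — `phi4JitterHMC(_PQP)_isReversible` — is the separate file
  `Phi4JitteredHMCReversible.lean`, which needs `JitteredHMCReversible.lean`.)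
* `phi4JitterHMC_apply` — it is the mixture `Σ_l η{l} · K_l` of the frozen-label HMC kernels.

NOT CLAIMED: ergodicity / irreducibility of any φ⁴ HMC chain (row 2: `Phi4HMCNoSpectralGap*.lean` — no
Doeblin power exists on `ℝ^Λ`); autocorrelations; floating point.
-/

noncomputable section

namespace Summit.Ventures.LatticeQCDFlow.Exactness

open MeasureTheory ProbabilityTheory ProbabilityTheory.Kernel Set Function Finset
open Summit.Ventures.LatticeQCDFlow.Scoring
open scoped ENNReal

variable {n : ℕ}

/-! ## §1 The Gaussian refresh as a normalised `withDensity` law -/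

/-- The unnormalised Gaussian momentum weight `e^{−½Σp²}·Leb` on `ℝ^{n+1}`. -/
def phi4KineticWeight (n : ℕ) : Measure (Fin (n + 1) → ℝ) :=
  (volume : Measure (Fin (n + 1) → ℝ)).withDensity fun p => ENNReal.ofReal (Real.exp (-((∑ x, p x ^ 2) / 2)))

/-- The Gaussian refresh law `Z_p⁻¹ e^{−½Σp²}·Leb = N(0,1)^{n+1}`. -/
def phi4KineticLaw (n : ℕ) : Measure (Fin (n + 1) → ℝ) :=
  (phi4KineticWeight n univ)⁻¹ • phi4KineticWeight n

/-- The kinetic term `½Σp²` is measurable. -/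
theorem measurable_phi4Kinetic : Measurable fun p : Fin (n + 1) → ℝ => (∑ x, p x ^ 2) / 2 := by
  fun_prop

/-- `Z_p = ENNReal.ofReal (momentumZ n)` (row 2's `momentumZ = ∫ e^{−½Σp²} dp`). -/
theorem phi4KineticWeight_univ_eq : phi4KineticWeight n univ = ENNReal.ofReal (momentumZ n) := by
  rw [phi4KineticWeight, withDensity_apply _ MeasurableSet.univ, Measure.restrict_univ, momentumZ,
    ofReal_integral_eq_lintegral_ofReal integrable_momentumWeight
      (ae_of_all _ fun p => (Real.exp_pos _).le)]
  refine lintegral_congr fun p => ?_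
  rw [momentumWeight, neg_div]

/-- `Z_p ≠ 0`. -/
theorem phi4KineticWeight_univ_ne_zero : phi4KineticWeight n univ ≠ 0 := by
  rw [phi4KineticWeight_univ_eq, Ne, ENNReal.ofReal_eq_zero, not_le]
  exact momentumZ_pos n

/-- `Z_p < ∞`. -/
theorem phi4KineticWeight_univ_ne_top : phi4KineticWeight n univ ≠ ⊤ := by
  rw [phi4KineticWeight_univ_eq]
  exact ENNReal.ofReal_ne_top

/-- The refresh law is a probability law. -/
instance isProbabilityMeasure_phi4KineticLaw : IsProbabilityMeasure (phi4KineticLaw n) :=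
  ⟨by rw [phi4KineticLaw, Measure.smul_apply, smul_eq_mul,
    ENNReal.inv_mul_cancel phi4KineticWeight_univ_ne_zero phi4KineticWeight_univ_ne_top]⟩

/-! ## §2 The jittered φ⁴ HMC kernels and their exactness -/

section Jitter

variable {Lab : Type*} [Countable Lab] [MeasurableSpace Lab] [MeasurableSingletonClass Lab]
variable (J : Fin (n + 1) → Fin (n + 1) → ℝ) (lam : ℝ) (δ : Lab → ℝ) (N : Lab → ℕ) (η : Measure Lab)

/-- **THE JITTERED qpq HMC UPDATE FOR LATTICE φ⁴** (`phi4_2d.hmc(..., tau_jitter)`): refresh `p ∼ N(0,1)^Λ`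
and an independent label `l ∼ η`, run `N l` qpq leapfrog steps of size `δ l`, flip, Metropolis test on
`S(φ) + ½Σp²`, forget `(p, l)`. -/
def phi4JitterHMC : Kernel (Fin (n + 1) → ℝ) (Fin (n + 1) → ℝ) :=
  jitterHMC (fun l => hmcProposal J lam (δ l) (N l))
    (measurable_jitterMap_of_countable fun l => measurable_hmcProposal J lam (δ l) (N l))
    (latticePhi4Action J lam) (fun p : Fin (n + 1) → ℝ => (∑ x, p x ^ 2) / 2) η (phi4KineticLaw n)

/-- **THE JITTERED pqp HMC UPDATE FOR LATTICE φ⁴** (`phi4_2d.hmcpqp(..., tau_jitter)`). -/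
def phi4JitterHMCPQP : Kernel (Fin (n + 1) → ℝ) (Fin (n + 1) → ℝ) :=
  jitterHMC (fun l => hmcProposalPQP J lam (δ l) (N l))
    (measurable_jitterMap_of_countable fun l => measurable_hmcProposalPQP J lam (δ l) (N l))
    (latticePhi4Action J lam) (fun p : Fin (n + 1) → ℝ => (∑ x, p x ^ 2) / 2) η (phi4KineticLaw n)

/-- **THE JITTERED qpq UPDATE IS EXACT, FOR EVERY JITTER LAW**: for every real `J`, `λ`, every
`δ : labels → ℝ`, `N : labels → ℕ` and every probability law `η` on a countable label set,
`phi4JitterHMC J λ δ N η` leaves `e^{−S}·Leb` invariant, `S = latticePhi4Action J λ`. -/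
theorem phi4JitterHMC_invariant [IsProbabilityMeasure η] :
    Invariant (phi4JitterHMC J lam δ N η)
      ((volume : Measure (Fin (n + 1) → ℝ)).withDensity fun φ =>
        ENNReal.ofReal (Real.exp (-latticePhi4Action J lam φ))) :=
  jitterHMC_exact (vol := (volume : Measure (Fin (n + 1) → ℝ))) (volP := (volume : Measure (Fin (n + 1) → ℝ)))
    η (continuous_latticePhi4Action J lam).measurable measurable_phi4Kinetic
    (fun l => hmcProposal_involutive J lam (δ l) (N l)) (fun l => measurePreserving_hmcProposal J lam (δ l) (N l))
    phi4KineticWeight_univ_ne_zero phi4KineticWeight_univ_ne_top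

/-- **THE JITTERED pqp UPDATE IS EXACT, FOR EVERY JITTER LAW.** -/
theorem phi4JitterHMCPQP_invariant [IsProbabilityMeasure η] :
    Invariant (phi4JitterHMCPQP J lam δ N η)
      ((volume : Measure (Fin (n + 1) → ℝ)).withDensity fun φ =>
        ENNReal.ofReal (Real.exp (-latticePhi4Action J lam φ))) :=
  jitterHMC_exact (vol := (volume : Measure (Fin (n + 1) → ℝ))) (volP := (volume : Measure (Fin (n + 1) → ℝ)))
    η (continuous_latticePhi4Action J lam).measurable measurable_phi4Kinetic
    (fun l => hmcProposalPQP_involutive J lam (δ l) (N l))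
    (fun l => measurePreserving_hmcProposalPQP J lam (δ l) (N l))
    phi4KineticWeight_univ_ne_zero phi4KineticWeight_univ_ne_top

/-- **A MIXTURE OF THE FROZEN-LABEL UPDATES**: `K_jit(φ, A) = Σ_l K_l(φ, A) · η{l}`, `K_l` the qpq HMC
kernel with step `δ l` and `N l` steps (refresh, propose, Metropolis test, forget — `refreshUpdate (involMH …)`). -/
theorem phi4JitterHMC_apply [SFinite η] (φ : Fin (n + 1) → ℝ) {A : Set (Fin (n + 1) → ℝ)} (hA : MeasurableSet A) :
    phi4JitterHMC J lam δ N η φ A =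
      ∑' l, refreshUpdate (involMH (hmcProposal J lam (δ l) (N l)) (measurable_hmcProposal J lam (δ l) (N l))
          fun z : (Fin (n + 1) → ℝ) × (Fin (n + 1) → ℝ) => latticePhi4Action J lam z.1 + (∑ x, z.2 x ^ 2) / 2)
        (phi4KineticLaw n) φ A * η {l} := by
  haveI : SFinite (phi4KineticLaw n) := by unfold phi4KineticLaw phi4KineticWeight; infer_instance
  rw [phi4JitterHMC, jitterHMC_apply _ _ η _ (continuous_latticePhi4Action J lam).measurable measurable_phi4Kinetic φ hA,
    lintegral_countable']

end Jitter

end Summit.Ventures.LatticeQCDFlow.Exactness
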